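import Summits.QuantumFields.YangMills.Theorems.UnitScaleTiltProp8FlatDomainsCongr
import Summits.QuantumFields.YangMills.Theorems.UnitScaleTiltProp8FlatMinimizerHLandau
import Summits.QuantumFields.YangMills.Theorems.UnitScaleTiltProp8FlatMinimizerHDecay
import HarnessLib

/-!
# Route `UnitScaleTilt`, crux K1 child «MinimiserStabilityRegPr» (stmt-QuantumFields-19200), v8 pillar **P2 `stub_flatOpsCubeSeq`** — OWNER RULING g21-№4 §B3(a)
# one-level target, `H`-side: **p1 g14's FLAT `H` (the [Balaban1984PropagatorsI] (1.63) minimiser `H_k`, transported) IS THE TEXT'S CANONICAL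
# `flatH = GQ*(QGQ*)⁻¹` OF THE ONE-LEVEL FAMILY `Domains.whole (K − n)`**, by the uniqueness of the critical configuration ([Balaban1984PropagatorsII] (2.35)), and hence
# **THE FIRST-ORDER KERNEL ROWS (k1), (k2) OF `FlatOpsHRowsFromKernels.HKernelRows` HOLD AT THE ONE-LEVEL FAMILY** with the physical distance `distBI` (p1 g14's
# `FlatMinimizerHDecay.abs_H_le_sum` / `abs_grad_H_le_sum`, [Balaban1984PropagatorsI] (1.63)–(1.66) decay)

Cell `ym3-torus` (HUMAN RULING D-0037, YM ladder rung R3), seat `ym3-torus-p1` gen 16.  `--supports stmt-QuantumFields-19200 --as helper`; count-neutral; def-free.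

THE PRINT.  [Balaban1984PropagatorsII] p. 228 (2.35): the critical configuration of `½‖∂A‖²` under `QA = B`, `R∂*A = 0` is unique and equals `HB = GQ*(QGQ*)⁻¹B`
(*«The only assumption we have used was the positivity of the operator Δ_a»*); p. 226: *«which is of course, a minimum of the functional (2.5)»*.  [Balaban1984PropagatorsI]
(1.63)–(1.66) p. 29: the one-level `H_k` = the minimiser of the quadratic form on `{Q_kA = B}` in the Landau gauge, with exponentially decaying kernel.
[Balaban1985Variational] (45)–(46) p. 285, (161) p. 303.

WHAT IS PROVED (sorry-free; axioms standard; no definition).  With `Hb := (tV hk).symm (pullR L (Mk P j) j (H_k *ᵥ cplx (tB b)))` (p1 g14's flat `H`, spelled out):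
* §1 `curlAction_ofLp_eq` — the dictionary `curlAction w c A = (w/2)·energy (dcE c) A` between [Balaban1984PropagatorsI] (1.3) and p21's (2.5) energy;
  `lamBond_whole_level` — an index bond of `whole j` sits at level `j`;
* §2 **`toLp_H_eq_hOp_whole`** — for data `X` on the index bonds `𝔅` of `whole j` (all at level `j`) and `b_X(c) := X(j, c)`: `Hb_X = hOp (GE (whole j)) (QsE) (EE) X` —
  `Hb_X` is admissible (`Q_j(Hb_X) = b_X` = p1 g14's `bondAvgIter_H_eq`; `R∂*(Hb_X) = 0` = `RE_dsE_H_eq_zero` transported from `twoScale j ∅` by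
  `FlatDomainsCongr.RE_apply_eq`) and minimises the energy (`curlAction_H_le`), hence is critical (`isCritical_of_isMinOn`) and equals `hOp … X` (`isCritical_iff_eq_hOp`);
* §3 **`flatH_whole_apply`** — at the carrier: `flatH F n K (whole (K−n)) X b = (Hb_X)(b)`;
  **`hKernelRows12_whole`** — THE KERNEL ROWS (k1), (k2) OF `HKernelRows` FOR `flatH` AT `whole (K − n)` with `dBI := distBI`, rate `κ₁₆₃(3)/3`, constants p1 g14's
  `MG163·periodConst`, `MD163·periodConst`: `|(flatH e_c)(b)| ≤ C₀e^{−κ·distBI(b,c)}`, `(L^{j(b)}η)η⁻¹|(flatH e_c)(b+e_ν) − (flatH e_c)(b)| ≤ C₁e^{−κ·distBI(b,c)}`.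
So at the one-level family the `H`-side of P2's input is reduced to the two SECOND-ORDER kernel rows (k3), (k4) ([Balaban1985Variational] (130), (139)–(140); not in the
one-level menu — C-B11-F1) and the (162) row sum for `distBI`.  HONEST SCOPE: bookkeeping over landed certificates; NOT a claim about the mass gap.

References: T. Bałaban, CMP **95** (1984) 17–40 [Balaban1984PropagatorsI] (1.3) p.18, (1.63)–(1.66) p.29; CMP **96** (1984) 223–250 [Balaban1984PropagatorsII] (2.5)–(2.6) p.224,
(2.35) p.228; CMP **102** (1985) 277–309 [Balaban1985Variational] (45)–(46) p.285, (161) p.303.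
-/

set_option autoImplicit false

noncomputable section

open scoped BigOperators InnerProductSpace Matrix

namespace Summit.QuantumFields.YangMills.Theorems.FlatHWholeBridge

open Literature.MathematicalPhysics.QuantumFieldTheory.Balaban1983to89
open Literature.MathematicalPhysics.QuantumFieldTheory.BalabanImbrieJaffe1984to88.BIJ85AxialPropagator411 (BondSpace)
open LatticeFieldCalculus (bondAvgIter curlAction curl)
open B6SectADomainsV1 (Domains)
open B6SectAOperatorsV1 (BondIdx BondIdxSpace QE QsE dsE dcE RE QE_apply dcE_apply)
open B6SectAVectorModelV1 (GE EE)
open B6SectACriticalPointV1 (isCritical_iff_eq_hOp)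
open B6Eq218Lagrangian (IsCritical Admissible energy isCritical_of_isMinOn)
open B6SectA (hOp)
open B6SectCTwoScaleV1 (twoScale)
open B5Eq117TorusCarriers (Mk tV tB)
open B5Eq118OneStroke (iterBlockOf)
open B5Prop12FieldsLattice (distSite)
open B5SectBStatements (cplx eta)
open B5TowerOneStroke (pullR)
open B5Hk163Torus (HkOp)
open B5Hk163TorusHolderDecay (MD163)
open B5Hk163Decay (MG163)
open B5Hk163Strip (kappa163)
open B4TorusKernel (periodConst)
open T3ContinuumYM3Torus (T3Family)
open FlatCubeOpsText (distBI IsLevWeight)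
open FlatOpsLettersAssembly (flatH)
open FlatDomainsCongr (lamBond_whole_iff lamSite_whole_iff lamBond_twoScale_empty_iff lamSite_twoScale_empty_iff RE_apply_eq)
open Prop7FlatCoercivityR (succ_le_T3)
open FlatMinimizerH (le_T3)

variable {P : Params} {j : ℕ}

/-! ## §1 Dictionary -/

/-- **[Balaban1984PropagatorsI] (1.3) vs [Balaban1984PropagatorsII] (2.5)**: `curlAction w c A = (w/2)·‖∂A‖²` with p21's `dcE c` (the ℓ² plaquette norm).
[cite: Balaban1984PropagatorsI, (1.3) p.18; Balaban1984PropagatorsII, (2.5) p.224] -/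
theorem curlAction_ofLp_eq (w c : ℝ) (y : BondSpace P) : curlAction w c (WithLp.ofLp y) = w / 2 * energy (dcE c) y := by
  unfold curlAction energy
  rw [EuclideanSpace.norm_sq_eq, Finset.mul_sum, Finset.mul_sum]
  refine Finset.sum_congr rfl fun p _ => ?_
  simp only [dcE_apply, Real.norm_eq_abs]
  ring

/-- every index bond of the all-torus family `whole j` is at level `j`. [cite: Balaban1984PropagatorsII, (2.1)-(2.4) p.224] -/
theorem lamBond_whole_level (hk : j ≤ P.m + P.K) (i : BondIdx (Domains.whole j hk : Domains P)) : (i.1.1 : ℕ) = j :=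
  (lamBond_whole_iff hk i.1.1 i.1.2).1 i.2

/-! ## §2 p1 g14's `H` is the canonical `hOp` of `whole j` -/

/-- **THE ONE-LEVEL FLAT `H` IS `GQ*(QGQ*)⁻¹` OF THE ALL-TORUS FAMILY** (uniqueness of the critical configuration, (2.35)): for data `X` on the index bonds of
`whole j` and its level-`j` reading `b_X(c) = X(j, c)`, p1 g14's `Hb_X` equals `hOp (GE (whole j)) (QsE (whole j)) (EE (whole j)) X` (lattice factor `L^j`, any
positive weights). [cite: Balaban1984PropagatorsII, (2.35) p.228, (2.5)-(2.6) p.224; Balaban1984PropagatorsI, (1.63) p.29] -/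
theorem toLp_H_eq_hOp_whole (hk : j ≤ P.m + P.K) (hj1 : j + 1 ≤ P.m + P.K) (hc : ((P.L : ℝ) ^ j) ≠ 0)
    {w : BondIdx (Domains.whole j hk : Domains P) → ℝ} (hw : ∀ i, 0 < w i) (X : BondIdx (Domains.whole j hk : Domains P) → ℝ) :
    WithLp.toLp 2 ((tV hk).symm (pullR P.L (Mk P j) j (HkOp (P.L ^ j) (Mk P j) *ᵥ
        cplx (tB (fun cb : PBond P j => X ⟨⟨⟨j, Nat.lt_succ_self j⟩, cb⟩, (lamBond_whole_iff hk j cb).2 rfl⟩))))) =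
      hOp (GE (Domains.whole j hk) hc hw) (QsE (Domains.whole j hk)) (EE (Domains.whole j hk) hc hw) (WithLp.toLp 2 X) := by
  haveI : NeZero P.L := ⟨P.L_pos.ne'⟩
  set bX : VecField P j ℝ := fun cb : PBond P j => X ⟨⟨⟨j, Nat.lt_succ_self j⟩, cb⟩, (lamBond_whole_iff hk j cb).2 rfl⟩ with hbX
  set Hg : VecField P 0 ℝ := (tV hk).symm (pullR P.L (Mk P j) j (HkOp (P.L ^ j) (Mk P j) *ᵥ cplx (tB bX))) with hHg
  rw [← isCritical_iff_eq_hOp (Domains.whole j hk) hc hw (WithLp.toLp 2 X) (WithLp.toLp 2 Hg)]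
  -- reading the constraint `Q(·) = X` on `whole j`: it is `Q_j(·) = b_X`
  have hread : ∀ y : BondSpace P, QE (Domains.whole j hk) y = WithLp.toLp 2 X ↔ bondAvgIter j (WithLp.ofLp y) = bX := by
    intro y
    constructor
    · intro h
      funext cb
      have := congrArg (fun v : BondIdxSpace (Domains.whole j hk) => v ⟨⟨⟨j, Nat.lt_succ_self j⟩, cb⟩, (lamBond_whole_iff hk j cb).2 rfl⟩) h
      simpa using this
    · intro h
      ext i
      obtain ⟨⟨⟨i₀, hi⟩, cb⟩, hmem⟩ := i
      obtain rfl : i₀ = j := (lamBond_whole_iff hk i₀ cb).1 hmem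
      rw [QE_apply]
      change bondAvgIter i₀ (WithLp.ofLp y) cb = X _
      rw [h]
  have hQ : QE (Domains.whole j hk) (WithLp.toLp 2 Hg) = WithLp.toLp 2 X :=
    (hread _).2 (by rw [hHg]; exact FlatMinimizerH.bondAvgIter_H_eq hk bX)
  have hR : RE (Domains.whole j hk) ((P.L : ℝ) ^ j) (dsE ((P.L : ℝ) ^ j) (WithLp.toLp 2 Hg)) = 0 := by
    rw [RE_apply_eq (D₁ := Domains.whole j hk) (D₂ := twoScale j hj1 (∅ : Finset (Site P (j + 1))))
      (fun i y => (lamSite_whole_iff hk i y).trans (lamSite_twoScale_empty_iff hj1 i y).symm)]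
    exact FlatMinimizerHLandau.RE_dsE_H_eq_zero hj1 bX
  refine isCritical_of_isMinOn ⟨hQ, hR⟩ fun y hy => ?_
  have hA : bondAvgIter j (WithLp.ofLp y) = bX := (hread y).1 hy.1
  have hmin := FlatMinimizerHLandau.curlAction_H_le hk bX (WithLp.ofLp y) hA
  rw [← hHg, show Hg = WithLp.ofLp (WithLp.toLp 2 Hg) from rfl, curlAction_ofLp_eq, curlAction_ofLp_eq] at hmin
  have hη : 0 < eta P.L j ^ P.d / 2 := by
    have : 0 < eta P.L j := by unfold eta; positivity
    positivity
  exact le_of_mul_le_mul_left hmin hη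

/-! ## §3 At the carrier: `flatH (whole (K − n))` and its first-order kernel rows -/

section Carrier

variable (F : T3Family) (n K : ℕ)

/-- **`flatH` OF THE ONE-LEVEL FAMILY IS p1 g14's FLAT `H`**, componentwise: `flatH F n K (whole (K−n)) X b = (Hb_X)(b)`.
[cite: Balaban1985Variational, (45) p.285; Balaban1984PropagatorsII, (2.35) p.228; Balaban1984PropagatorsI, (1.63) p.29] -/
theorem flatH_whole_apply (X : BondIdx (Domains.whole (K - n) (le_T3 F n K) : Domains (F.P K)) → ℝ) (b : PBond (F.P K) 0) :
    flatH F n K (Domains.whole (K - n) (le_T3 F n K)) X b =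
      (tV (le_T3 F n K)).symm (pullR (F.P K).L (Mk (F.P K) (K - n)) (K - n) (HkOp ((F.P K).L ^ (K - n)) (Mk (F.P K) (K - n)) *ᵥ
        cplx (tB (fun cb : PBond (F.P K) (K - n) =>
          X ⟨⟨⟨K - n, Nat.lt_succ_self (K - n)⟩, cb⟩, (lamBond_whole_iff (le_T3 F n K) (K - n) cb).2 rfl⟩)))) b := by
  have h := toLp_H_eq_hOp_whole (P := F.P K) (le_T3 F n K) (succ_le_T3 F n K)
    (pow_ne_zero _ (Nat.cast_ne_zero.2 (F.P K).L_pos.ne')) (w := fun _ => (1 : ℝ)) (fun _ => one_pos) X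
  have hb := congrArg (fun v : BondSpace (F.P K) => v b) h
  simp only at hb
  rw [FlatOpsLettersAssembly.isFlatH_flatH F n K _ X b]
  exact hb.symm

/-- **THE FIRST-ORDER KERNEL ROWS (k1), (k2) OF `HKernelRows` AT THE ONE-LEVEL FAMILY, WITH THE PHYSICAL DISTANCE** `dBI := distBI` (= the level-`(K−n)` sup circular
distance of the block of `b₋` to `c₋` there), rate `κ₁₆₃(3)/3`: `|(flatH e_c)(b)| ≤ C₀·e^{−κ·distBI(b,c)}` and `(L^{j(b)}η)·η⁻¹·|(flatH e_c)(b+e_ν) − (flatH e_c)(b)| ≤ C₁·e^{−κ·distBI(b,c)}`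
with p1 g14's constants — [Balaban1984PropagatorsI] (1.63)–(1.66) through `FlatMinimizerHDecay`. [cite: Balaban1984PropagatorsI, (1.63)-(1.66) p.29; Balaban1984PropagatorsII, Cor. 2.8 (2.150)-(2.151) p.249; Balaban1985Variational, (161) p.303] -/
theorem hKernelRows12_whole (w : ℕ → PBond (F.P K) 0 → ℝ) (hw : IsLevWeight F n K (Domains.whole (K - n) (le_T3 F n K)) w)
    (c : BondIdx (Domains.whole (K - n) (le_T3 F n K) : Domains (F.P K))) (e : BondIdx (Domains.whole (K - n) (le_T3 F n K) : Domains (F.P K)) → ℝ)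
    (he : e c = 1) (he' : ∀ c', c' ≠ c → e c' = 0) (b : PBond (F.P K) 0) :
    |flatH F n K (Domains.whole (K - n) (le_T3 F n K)) e b| ≤
        MG163 3 * periodConst (kappa163 3) (3 - 1) * Real.exp (-(kappa163 3 / 3 * distBI (Domains.whole (K - n) (le_T3 F n K)) b c)) ∧
      ∀ ν : Fin 3, w 1 b * (F.L : ℝ) ^ (K - n) *
          |flatH F n K (Domains.whole (K - n) (le_T3 F n K)) e ⟨b.src.shift ν, b.dir⟩ - flatH F n K (Domains.whole (K - n) (le_T3 F n K)) e b| ≤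
        MD163 3 * periodConst (kappa163 3) (3 - 1) * Real.exp (-(kappa163 3 / 3 * distBI (Domains.whole (K - n) (le_T3 F n K)) b c)) := by
  -- the index bond `c` is `(K − n, cb)`
  obtain ⟨⟨⟨j₀, hj₀⟩, cb⟩, hmem⟩ := c
  obtain rfl : j₀ = K - n := (lamBond_whole_iff (le_T3 F n K) j₀ cb).1 hmem
  -- the level-(K−n) reading of the indicator `e` is the indicator of `cb`
  have hbX_cb : (fun cb' : PBond (F.P K) (K - n) =>
      e ⟨⟨⟨K - n, Nat.lt_succ_self (K - n)⟩, cb'⟩, (lamBond_whole_iff (le_T3 F n K) (K - n) cb').2 rfl⟩) cb = 1 := he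
  have hbX_ne : ∀ cb' : PBond (F.P K) (K - n), cb' ≠ cb → (fun cb'' : PBond (F.P K) (K - n) =>
      e ⟨⟨⟨K - n, Nat.lt_succ_self (K - n)⟩, cb''⟩, (lamBond_whole_iff (le_T3 F n K) (K - n) cb'').2 rfl⟩) cb' = 0 := by
    intro cb' hne
    refine he' _ fun h => hne ?_
    have := congrArg (fun i : BondIdx (Domains.whole (K - n) (le_T3 F n K) : Domains (F.P K)) => i.1) h
    simpa using this
  -- the kernel sums of `FlatMinimizerHDecay` against the indicator collapse to one term
  have hsum : ∀ (s : Site (F.P K) 0),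
      ∑ y : Site (F.P K) (K - n), ∑ lam : Fin (F.P K).d,
          Real.exp (-(kappa163 (F.P K).d / (F.P K).d * distSite (Mk (F.P K) (K - n)) (iterBlockOf (K - n) s) y)) *
            |(fun cb' : PBond (F.P K) (K - n) =>
              e ⟨⟨⟨K - n, Nat.lt_succ_self (K - n)⟩, cb'⟩, (lamBond_whole_iff (le_T3 F n K) (K - n) cb').2 rfl⟩) ⟨y, lam⟩| =
        Real.exp (-(kappa163 3 / 3 * distSite (Mk (F.P K) (K - n)) (iterBlockOf (K - n) s) cb.src)) := by
    intro s
    rw [Finset.sum_eq_single cb.src, Finset.sum_eq_single cb.dir]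
    · rw [show (⟨cb.src, cb.dir⟩ : PBond (F.P K) (K - n)) = cb from rfl, hbX_cb, abs_one, mul_one]
      rfl
    · intro lam _ hlam
      rw [hbX_ne ⟨cb.src, lam⟩ (fun h => hlam (by rw [← h])), abs_zero, mul_zero]
    · intro h; exact absurd (Finset.mem_univ _) h
    · intro y _ hy
      refine Finset.sum_eq_zero fun lam _ => ?_
      rw [hbX_ne ⟨y, lam⟩ (fun h => hy (by rw [← h])), abs_zero, mul_zero]
    · intro h; exact absurd (Finset.mem_univ _) h
  -- `distBI` at the top level is the plain block distance
  have hdist : ∀ b' : PBond (F.P K) 0, distBI (Domains.whole (K - n) (le_T3 F n K))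
      b' ⟨⟨⟨K - n, hj₀⟩, cb⟩, hmem⟩ = distSite (Mk (F.P K) (K - n)) (iterBlockOf (K - n) b'.src) cb.src := by
    intro b'
    change ((F.L : ℝ)⁻¹) ^ ((K - n) - (K - n)) * distSite (Mk (F.P K) (K - n)) (iterBlockOf (K - n) b'.src) cb.src = _
    rw [Nat.sub_self, pow_zero, one_mul]
  refine ⟨?_, fun ν => ?_⟩
  · rw [flatH_whole_apply, hdist]
    have h1 := FlatMinimizerHDecay.abs_H_le_sum (P := F.P K) (le_T3 F n K) (fun cb' : PBond (F.P K) (K - n) =>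
      e ⟨⟨⟨K - n, Nat.lt_succ_self (K - n)⟩, cb'⟩, (lamBond_whole_iff (le_T3 F n K) (K - n) cb').2 rfl⟩) b
    rw [hsum] at h1
    exact h1
  · rw [flatH_whole_apply, flatH_whole_apply, hdist, FlatCubeOpsTextWhole.levWeight_whole_eq_one F n K (le_T3 F n K) w hw 1 b, one_mul]
    have h2 := FlatMinimizerHDecay.abs_grad_H_le_sum (P := F.P K) (le_T3 F n K) (fun cb' : PBond (F.P K) (K - n) =>
      e ⟨⟨⟨K - n, Nat.lt_succ_self (K - n)⟩, cb'⟩, (lamBond_whole_iff (le_T3 F n K) (K - n) cb').2 rfl⟩) b.src b.dir ν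
    rw [hsum] at h2
    exact h2

end Carrier

end Summit.QuantumFields.YangMills.Theorems.FlatHWholeBridge

end
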